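import Summits.Ventures.CertifiedManyBodySolver.Transport.ChainWindowReflectionRows
import HarnessLib

/-!
# Ventures/CertifiedManyBodySolver — Transport/ChainWindowParticleHole.lean

Speedrun cell sr-mbsolver — LIT team (lit-1 gen-7), LEAD r118 (c) "STAGE 3", part B3 (1 of 2): THE BIPARTITE PARTICLE–HOLE UNITARY.
HONEST FRAMING: first certified bounds; not a superconductivity verdict; every number certified or labelled float.

The third generator of op-08's identification group at HALF FILLING (`code/oplayer/fockspace.py`: `particle_hole`, the CAR
automorphism `c_{p,σ} ↦ (−1)^p c†_{p,σ}` applied letter by letter to `c†_{m₁}⋯c†_{m_r}|vac⟩` with `U|vac⟩ = |full⟩`) is, in the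
occupation basis `|0⟩,|↑⟩,|↓⟩,|↑↓⟩` per site, the PRODUCT of the one-site signed permutations
`uPH ε = (|3−b⟩⟨b| · t_ε(b))_b`, `t_ε = (1, ε, −ε, −1)`, `ε = (−1)^p` (`p = x + 1` the position of site `x ∈ {-1, …, n+1}`):
`phOp n = ⨂_x uPH (phSign x)`, `phSign x = (−1)^{x+1}`. This file proves the one-site table — `u c_σ u† = ε c†_σ`,
`u c†_σ u† = ε c_σ`, `u (c†_σ F) u† = −ε F c_σ`, `u (F c_σ) u† = −ε c†_σ F`, `u n_σ u† = 1 − n_σ`, `u (n_↑n_↓) u† = (1−n_↑)(1−n_↓)`,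
`u† = −u`, `u² = −1`, `F u = u F = uPH(−ε)`, `u_SF u = −u u_SF`, `d u d = −F u` (`d = diag(1,1,1,−1)`) — the sign bookkeeping
`phSign (x+1) = −phSign x`, `phSign (a − x) = −phSign a · phSign x`, and the configuration-level facts: `⨂_x uPH(ε_x)` is a signed
permutation `k ↦ 3 − k` (so it maps the sector `(N_↑, N_↓)` to `(k − N_↑, k − N_↓)` and preserves sector zeros and reality),
`(⨂u)² = (−1)^{#sites}` (so `U² ρ U²ᴴ = ρ`), and the fermion parity `Π = ⨂_x F` acts trivially on sector-block-diagonal matrices.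
Part 2 (`ChainWindowParticleHoleRows.lean`) treats the rows with partial traces, the density row (`ν ↦ 2 − ν`) and the objective.
No sorry, no axiom; definitions with bodies: `uPH`, `phSign`, `phOp`.
[cite: EsslerEtAl2005, §12.3.4 eqs. (12.196)–(12.201); §2.2.4 (particle–hole transformation)] [cite: LiebWu1968, eq. (4)] [cite: KullEtAl2024, §II.B]
-/

noncomputable section

open Matrix Complex
open scoped ComplexOrder BigOperators
open Literature.Probability.LatticeModels
open Literature.MathematicalPhysics.QuantumLattice
open Literature.MathematicalPhysics.QuantumLattice.HubbardWave0
open Literature.MathematicalPhysics.QuantumLattice.JordanWigner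

namespace Summit.Ventures.CertifiedManyBodySolver.Transport

/-! ### §1 The one-site particle–hole matrix `uPH ε` -/

section Site

/-- **The one-site bipartite particle–hole matrix** `⟨a| uPH ε |b⟩ = [a = 3 − b] · t_ε(b)`, `t_ε = (1, ε, −ε, −1)` (basis
`|0⟩,|↑⟩,|↓⟩,|↑↓⟩`; `ε = (−1)^p` the bipartite sign of the site): the Fock matrix of `c_σ ↦ ε c†_σ` on one site with `|0⟩ ↦ |↑↓⟩`.
[cite: EsslerEtAl2005, §2.2.4, §12.3.4] -/
def uPH (ε : ℂ) : Matrix (Fin 4) (Fin 4) ℂ := !![0, 0, 0, -1; 0, 0, -ε, 0; 0, ε, 0, 0; 1, 0, 0, 0]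

/-- `uPH ε` is a signed permutation: `u a b = [b = 3 − a] · (−1, −ε, ε, 1)_a`. [folklore] -/
theorem uPH_apply (ε : ℂ) (a b : Fin 4) :
    uPH ε a b = if b = (![3, 2, 1, 0] : Fin 4 → Fin 4) a then (![-1, -ε, ε, 1] : Fin 4 → ℂ) a else 0 := by
  fin_cases a <;> fin_cases b <;> simp [uPH]

/-- `u² = −1` (for `ε² = 1`). [folklore] -/
theorem uPH_mul_self {ε : ℂ} (hε : ε = 1 ∨ ε = -1) : uPH ε * uPH ε = -1 := by
  rcases hε with rfl | rfl <;> (ext a b; fin_cases a <;> fin_cases b <;> simp [uPH, Matrix.mul_apply, Fin.sum_univ_four])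

/-- `uᴴ = −u` (real antisymmetric, `ε = ±1`). [folklore] -/
theorem uPH_conjTranspose {ε : ℂ} (hε : ε = 1 ∨ ε = -1) : (uPH ε)ᴴ = -uPH ε := by
  rcases hε with rfl | rfl <;> (ext a b; fin_cases a <;> fin_cases b <;> simp [uPH, Matrix.conjTranspose_apply])

/-- `uᴴ u = 1`. [folklore] -/
theorem uPH_conjTranspose_mul_self {ε : ℂ} (hε : ε = 1 ∨ ε = -1) : (uPH ε)ᴴ * uPH ε = 1 := by
  rw [uPH_conjTranspose hε, Matrix.neg_mul, uPH_mul_self hε, neg_neg]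

/-- `u uᴴ = 1`. [folklore] -/
theorem uPH_mul_conjTranspose_self {ε : ℂ} (hε : ε = 1 ∨ ε = -1) : uPH ε * (uPH ε)ᴴ = 1 := by
  rw [uPH_conjTranspose hε, Matrix.mul_neg, uPH_mul_self hε, neg_neg]

/-- `uPH ε` is unitary. [folklore] -/
theorem uPH_mem_unitaryGroup {ε : ℂ} (hε : ε = 1 ∨ ε = -1) : uPH ε ∈ Matrix.unitaryGroup (Fin 4) ℂ := by
  rw [Matrix.mem_unitaryGroup_iff, Matrix.star_eq_conjTranspose]
  exact uPH_mul_conjTranspose_self hε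

/-- **`u c_σ u† = ε c†_σ`.** [cite: EsslerEtAl2005, §2.2.4, §12.3.4 eqs. (12.199)–(12.201)] -/
theorem uPH_conj_siteAnnihilation {ε : ℂ} (hε : ε = 1 ∨ ε = -1) (σ : Fin 2) :
    uPH ε * siteAnnihilation σ * (uPH ε)ᴴ = ε • siteCreation σ := by
  rw [uPH_conjTranspose hε]
  have h0 : ∀ ε : ℂ, uPH ε * siteAnnihilation 0 * -uPH ε = ε • siteCreation 0 := fun ε => by
    rw [siteAnnihilation_zero_eq, siteCreation_zero_eq]
    ext a b; fin_cases a <;> fin_cases b <;> simp [uPH, Matrix.mul_apply, Fin.sum_univ_four]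
  have h1 : ∀ ε : ℂ, uPH ε * siteAnnihilation 1 * -uPH ε = ε • siteCreation 1 := fun ε => by
    rw [siteAnnihilation_one_eq, siteCreation_one_eq]
    ext a b; fin_cases a <;> fin_cases b <;> simp [uPH, Matrix.mul_apply, Fin.sum_univ_four]
  fin_cases σ
  · exact h0 ε
  · exact h1 ε

/-- **`u c†_σ u† = ε c_σ`.** [cite: EsslerEtAl2005, §2.2.4, §12.3.4 eqs. (12.199)–(12.201)] -/
theorem uPH_conj_siteCreation {ε : ℂ} (hε : ε = 1 ∨ ε = -1) (σ : Fin 2) :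
    uPH ε * siteCreation σ * (uPH ε)ᴴ = ε • siteAnnihilation σ := by
  rw [uPH_conjTranspose hε]
  have h0 : ∀ ε : ℂ, uPH ε * siteCreation 0 * -uPH ε = ε • siteAnnihilation 0 := fun ε => by
    rw [siteAnnihilation_zero_eq, siteCreation_zero_eq]
    ext a b; fin_cases a <;> fin_cases b <;> simp [uPH, Matrix.mul_apply, Fin.sum_univ_four]
  have h1 : ∀ ε : ℂ, uPH ε * siteCreation 1 * -uPH ε = ε • siteAnnihilation 1 := fun ε => by
    rw [siteAnnihilation_one_eq, siteCreation_one_eq]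
    ext a b; fin_cases a <;> fin_cases b <;> simp [uPH, Matrix.mul_apply, Fin.sum_univ_four]
  fin_cases σ
  · exact h0 ε
  · exact h1 ε

/-- `u (c†_σ F) u† = −ε F c_σ`. [cite: EsslerEtAl2005, §12.3.4 eqs. (12.198)–(12.201)] -/
theorem uPH_conj_siteCreation_mul_siteParity {ε : ℂ} (hε : ε = 1 ∨ ε = -1) (σ : Fin 2) :
    uPH ε * (siteCreation σ * siteParity) * (uPH ε)ᴴ = (-ε) • (siteParity * siteAnnihilation σ) := by
  rw [uPH_conjTranspose hε]
  have h0 : ∀ ε : ℂ, uPH ε * (siteCreation 0 * siteParity) * -uPH ε = (-ε) • (siteParity * siteAnnihilation 0) := fun ε => by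
    rw [siteCreation_zero_mul_siteParity, siteParity_mul_siteAnnihilation_zero]
    ext a b; fin_cases a <;> fin_cases b <;> simp [uPH, Matrix.mul_apply, Fin.sum_univ_four]
  have h1 : ∀ ε : ℂ, uPH ε * (siteCreation 1 * siteParity) * -uPH ε = (-ε) • (siteParity * siteAnnihilation 1) := fun ε => by
    rw [siteCreation_one_mul_siteParity, siteParity_mul_siteAnnihilation_one]
    ext a b; fin_cases a <;> fin_cases b <;> simp [uPH, Matrix.mul_apply, Fin.sum_univ_four]
  fin_cases σ
  · exact h0 ε
  · exact h1 ε

/-- `u (F c_σ) u† = −ε c†_σ F`. [cite: EsslerEtAl2005, §12.3.4 eqs. (12.198)–(12.201)] -/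
theorem uPH_conj_siteParity_mul_siteAnnihilation {ε : ℂ} (hε : ε = 1 ∨ ε = -1) (σ : Fin 2) :
    uPH ε * (siteParity * siteAnnihilation σ) * (uPH ε)ᴴ = (-ε) • (siteCreation σ * siteParity) := by
  rw [uPH_conjTranspose hε]
  have h0 : ∀ ε : ℂ, uPH ε * (siteParity * siteAnnihilation 0) * -uPH ε = (-ε) • (siteCreation 0 * siteParity) := fun ε => by
    rw [siteCreation_zero_mul_siteParity, siteParity_mul_siteAnnihilation_zero]
    ext a b; fin_cases a <;> fin_cases b <;> simp [uPH, Matrix.mul_apply, Fin.sum_univ_four]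
  have h1 : ∀ ε : ℂ, uPH ε * (siteParity * siteAnnihilation 1) * -uPH ε = (-ε) • (siteCreation 1 * siteParity) := fun ε => by
    rw [siteCreation_one_mul_siteParity, siteParity_mul_siteAnnihilation_one]
    ext a b; fin_cases a <;> fin_cases b <;> simp [uPH, Matrix.mul_apply, Fin.sum_univ_four]
  fin_cases σ
  · exact h0 ε
  · exact h1 ε

/-- **`u n_σ u† = 1 − n_σ`.** [cite: EsslerEtAl2005, §2.2.4] -/
theorem uPH_conj_siteNumber {ε : ℂ} (hε : ε = 1 ∨ ε = -1) (σ : Fin 2) :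
    uPH ε * siteNumber σ * (uPH ε)ᴴ = 1 - siteNumber σ := by
  rw [uPH_conjTranspose hε]
  have h0 : uPH ε * siteNumber 0 * -uPH ε = 1 - siteNumber 0 := by
    rw [siteNumber_zero_eq]
    rcases hε with rfl | rfl <;> (ext a b; fin_cases a <;> fin_cases b <;> simp [uPH, Matrix.mul_apply, Fin.sum_univ_four])
  have h1 : uPH ε * siteNumber 1 * -uPH ε = 1 - siteNumber 1 := by
    rw [siteNumber_one_eq]
    rcases hε with rfl | rfl <;> (ext a b; fin_cases a <;> fin_cases b <;> simp [uPH, Matrix.mul_apply, Fin.sum_univ_four])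
  fin_cases σ
  · exact h0
  · exact h1

/-- **`u (n_↑ n_↓) u† = (1 − n_↑)(1 − n_↓) = 1 − n_↑ − n_↓ + n_↑ n_↓`.** [cite: EsslerEtAl2005, §2.2.4] -/
theorem uPH_conj_siteDouble {ε : ℂ} (hε : ε = 1 ∨ ε = -1) :
    uPH ε * siteDouble * (uPH ε)ᴴ = 1 - siteNumber 0 - siteNumber 1 + siteDouble := by
  rw [uPH_conjTranspose hε, siteDouble_eq, siteNumber_zero_eq, siteNumber_one_eq]
  rcases hε with rfl | rfl <;> (ext a b; fin_cases a <;> fin_cases b <;> simp [uPH, Matrix.mul_apply, Fin.sum_univ_four])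

/-- `F u = uPH(−ε)`: flipping the bipartite sign is left multiplication by the site parity. [folklore] -/
theorem siteParity_mul_uPH (ε : ℂ) : siteParity * uPH ε = uPH (-ε) := by
  rw [siteParity_eq]
  ext a b; fin_cases a <;> fin_cases b <;> simp [uPH, Matrix.mul_apply, Fin.sum_univ_four]

/-- `u F = uPH(−ε)`; hence `F u = u F`. [folklore] -/
theorem uPH_mul_siteParity (ε : ℂ) : uPH ε * siteParity = uPH (-ε) := by
  rw [siteParity_eq]
  ext a b; fin_cases a <;> fin_cases b <;> simp [uPH, Matrix.mul_apply, Fin.sum_univ_four]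

/-- The spin flip ANTIcommutes with `u` on one site: `u_SF u = −u u_SF`. [folklore] -/
theorem uSpinFlip_mul_uPH (ε : ℂ) : uSpinFlip * uPH ε = -(uPH ε * uSpinFlip) := by
  ext a b; fin_cases a <;> fin_cases b <;> simp [uPH, uSpinFlip, Matrix.mul_apply, Fin.sum_univ_four]

/-- The reflection twist: `d u d = −F u` (`d = diag(1,1,1,−1)`). [folklore] -/
theorem uDouble_mul_uPH_mul_uDouble (ε : ℂ) : uDouble * uPH ε * uDouble = -(siteParity * uPH ε) := by
  rw [siteParity_eq]
  ext a b; fin_cases a <;> fin_cases b <;> simp [uPH, uDouble, Matrix.mul_apply, Fin.sum_univ_four]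

/-- `3 − (3 − a) = a`. [folklore] -/
theorem ph_perm_involutive (a : Fin 4) : (![3, 2, 1, 0] : Fin 4 → Fin 4) ((![3, 2, 1, 0] : Fin 4 → Fin 4) a) = a := by
  fin_cases a <;> rfl

/-- `σ` is occupied in `3 − a` iff it is empty in `a`. [folklore] -/
theorem mem_siteOcc_ph_iff (σ : Fin 2) (a : Fin 4) : σ ∈ siteOcc ((![3, 2, 1, 0] : Fin 4 → Fin 4) a) ↔ σ ∉ siteOcc a := by
  fin_cases σ <;> fin_cases a <;> simp [siteOcc]

end Site

/-! ### §2 The bipartite sign `phSign x = (−1)^{x+1}` -/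

section Sign

/-- **The bipartite sign of site `x`**: `ε = (−1)^p` with `p = x + 1` the position of `x` in the window `{-1, …, n+1}`
(fockspace's default `eps(p) = (−1)^p`). [folklore] -/
def phSign (x : ℤ) : ℂ := if Even x then -1 else 1

/-- `ε_x = ±1`. [folklore] -/
theorem phSign_cases (x : ℤ) : phSign x = 1 ∨ phSign x = -1 := by
  unfold phSign; split_ifs <;> simp

/-- `ε_{x+1} = −ε_x` (the chain is bipartite). [folklore] -/
theorem phSign_add_one (x : ℤ) : phSign (x + 1) = -phSign x := by
  unfold phSign
  by_cases h : Even x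
  · rw [if_pos h, if_neg (Int.even_add_one.not.mpr (not_not.mpr h)), neg_neg]
  · rw [if_neg h, if_pos (Int.even_add_one.mpr h)]

/-- `ε_{a−x} = −ε_a ε_x` (the reflection `x ↦ a − x` multiplies every sign by the SAME `−ε_a`). [folklore] -/
theorem phSign_sub (a x : ℤ) : phSign (a - x) = -(phSign a * phSign x) := by
  unfold phSign
  by_cases ha : Even a <;> by_cases hx : Even x <;> simp [Int.even_sub, ha, hx]

/-- `phSign x * phSign x = 1`. [folklore] -/
theorem phSign_mul_self (x : ℤ) : phSign x * phSign x = 1 := by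
  rcases phSign_cases x with h | h <;> simp [h]

end Sign

/-! ### §3 Products `⨂_x uPH(ε_x)` over a sign family; the window operator `phOp n`; the fermion parity `Π` -/

section Product

variable {Y : Type} [Fintype Y] [DecidableEq Y] {q : ℕ}

omit [DecidableEq Y] in
/-- Site-wise scalars factor out of a product operator: `⨂_y (c_y • u_y) = (∏_y c_y) • ⨂_y u_y`. [folklore] -/
theorem productOp_smul (c : Y → ℂ) (u : Y → Matrix (Fin q) (Fin q) ℂ) :
    productOp (fun y => c y • u y) = (∏ y, c y) • productOp u := by
  ext σ τ
  simp only [productOp_apply, Matrix.smul_apply, smul_eq_mul, Finset.prod_mul_distrib]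

/-- **`(⨂u)² = (−1)^{#sites}`**, hence `U² ρ U²ᴴ = ρ`. [folklore] -/
theorem phProd_sq_conj {ε : Y → ℂ} (hε : ∀ y, ε y = 1 ∨ ε y = -1) (ρ : Op Y 4) :
    (productOp (fun y => uPH (ε y)) * productOp (fun y => uPH (ε y))) * ρ *
      (productOp (fun y => uPH (ε y)) * productOp (fun y => uPH (ε y)))ᴴ = ρ := by
  have hsq : productOp (fun y => uPH (ε y)) * productOp (fun y => uPH (ε y)) = ((-1 : ℂ) ^ Fintype.card Y) • (1 : Op Y 4) := by
    rw [productOp_mul, show (fun y => uPH (ε y) * uPH (ε y)) = fun y => (-1 : ℂ) • (1 : Matrix (Fin 4) (Fin 4) ℂ) from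
      funext fun y => by rw [uPH_mul_self (hε y), neg_one_smul], productOp_smul, productOp_one, Finset.prod_const, Finset.card_univ]
  rw [hsq, Matrix.conjTranspose_smul, Matrix.conjTranspose_one, Matrix.smul_mul, Matrix.one_mul, Matrix.mul_smul, Matrix.mul_one,
    smul_smul, star_pow, star_neg, star_one, ← mul_pow, neg_one_mul, neg_neg, one_pow, one_smul]

/-- `Uᴴ U = 1` for `U = ⨂_y uPH(ε_y)`. [folklore] -/
theorem phProd_conjTranspose_mul_self {ε : Y → ℂ} (hε : ∀ y, ε y = 1 ∨ ε y = -1) :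
    (productOp (fun y => uPH (ε y)))ᴴ * productOp (fun y => uPH (ε y)) = 1 :=
  productOp_conjTranspose_mul fun y => uPH_conjTranspose_mul_self (hε y)

omit [DecidableEq Y] in
/-- `⨂_y uPH(ε_y)` is the signed permutation `k ↦ 3 − k` of configurations. [folklore] -/
theorem phProd_apply (ε : Y → ℂ) (k l : TensorIndex Y 4) :
    productOp (fun y => uPH (ε y)) k l =
      if l = (fun y => (![3, 2, 1, 0] : Fin 4 → Fin 4) (k y)) then ∏ y, (![-1, -(ε y), ε y, 1] : Fin 4 → ℂ) (k y) else 0 :=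
  productOp_apply_of_signedPerm (u := fun y => uPH (ε y)) (fun _ => ![3, 2, 1, 0]) (fun y => ![-1, -(ε y), ε y, 1])
    (fun y a b => uPH_apply (ε y) a b) k l

omit [DecidableEq Y] in
/-- The particle–hole map sends the count `N_σ` to `#sites − N_σ`. [folklore] -/
theorem sectorCount_ph (σ : Fin 2) (k : TensorIndex Y 4) :
    (∑ x, if σ ∈ siteOcc ((![3, 2, 1, 0] : Fin 4 → Fin 4) (k x)) then 1 else 0 : ℕ) + (∑ x, if σ ∈ siteOcc (k x) then 1 else 0 : ℕ) =
      Fintype.card Y := by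
  rw [← Finset.sum_add_distrib, ← Finset.card_univ, Finset.card_eq_sum_ones]
  refine Finset.sum_congr rfl fun x _ => ?_
  rw [if_congr (mem_siteOcc_ph_iff σ (k x)) rfl rfl]
  by_cases h : σ ∈ siteOcc (k x) <;> simp [h]

/-- **Sector zeros survive the particle–hole map.** [folklore] -/
theorem phProd_sectorRow (ε : Y → ℂ) {ρ : Op Y 4}
    (hρ : ∀ σ : Fin 2, ∀ k k' : TensorIndex Y 4,
      (∑ x, if σ ∈ siteOcc (k x) then 1 else 0 : ℕ) ≠ (∑ x, if σ ∈ siteOcc (k' x) then 1 else 0 : ℕ) → ρ k k' = 0)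
    (σ : Fin 2) (k k' : TensorIndex Y 4)
    (hk : (∑ x, if σ ∈ siteOcc (k x) then 1 else 0 : ℕ) ≠ (∑ x, if σ ∈ siteOcc (k' x) then 1 else 0 : ℕ)) :
    (productOp (fun y => uPH (ε y)) * ρ * (productOp (fun y => uPH (ε y)))ᴴ) k k' = 0 := by
  refine sectorRow_signedPerm_conj (fun k y => (![3, 2, 1, 0] : Fin 4 → Fin 4) (k y)) _ (phProd_apply ε)
    (fun (σ : Fin 2) (k : TensorIndex Y 4) => (∑ x, if σ ∈ siteOcc (k x) then 1 else 0 : ℕ)) ?_ hρ σ k k' hk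
  intro τ l l' hl
  refine ⟨τ, fun h => hl ?_⟩
  have h1 := sectorCount_ph τ l
  have h2 := sectorCount_ph τ l'
  dsimp only at h
  omega

/-- **Real entries survive the particle–hole map** (`ε` real). [folklore] -/
theorem phProd_realRow {ε : Y → ℂ} (hε : ∀ y, ε y = 1 ∨ ε y = -1) {ρ : Op Y 4} (hρ : ∀ k k', starRingEnd ℂ (ρ k k') = ρ k k')
    (k k' : TensorIndex Y 4) :
    starRingEnd ℂ ((productOp (fun y => uPH (ε y)) * ρ * (productOp (fun y => uPH (ε y)))ᴴ) k k') =
      (productOp (fun y => uPH (ε y)) * ρ * (productOp (fun y => uPH (ε y)))ᴴ) k k' := by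
  refine realRow_signedPerm_conj _ _ (phProd_apply ε) (fun l => ?_) hρ k k'
  rw [star_prod]
  refine Finset.prod_congr rfl fun y _ => ?_
  generalize l y = a
  rcases hε y with h | h <;> (fin_cases a <;> simp [h])

/-- **The fermion parity `Π = ⨂_x F` acts trivially on sector-block-diagonal matrices** (`F = diag(1,−1,−1,1)`, sign
`(−1)^{N_↑ + N_↓}` is constant on a sector). [folklore] -/
theorem parity_conj_of_sectorRow {ρ : Op Y 4}
    (hρ : ∀ σ : Fin 2, ∀ k k' : TensorIndex Y 4,
      (∑ x, if σ ∈ siteOcc (k x) then 1 else 0 : ℕ) ≠ (∑ x, if σ ∈ siteOcc (k' x) then 1 else 0 : ℕ) → ρ k k' = 0) :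
    productOp (fun _ : Y => siteParity) * ρ * (productOp (fun _ : Y => siteParity))ᴴ = ρ := by
  -- `F a b = [b = a] · f(a)`, `f(a) = (−1)^{[↑ ∈ a]} (−1)^{[↓ ∈ a]}`
  have hF : ∀ (_ : Y) (a b : Fin 4), siteParity a b = if b = (fun c : Fin 4 => c) a then
      (fun c : Fin 4 => ((-1 : ℂ) ^ (if (0 : Fin 2) ∈ siteOcc c then 1 else 0 : ℕ)) *
        (-1 : ℂ) ^ (if (1 : Fin 2) ∈ siteOcc c then 1 else 0 : ℕ)) a else 0 := by
    intro _ a b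
    rw [siteParity_eq]
    fin_cases a <;> fin_cases b <;> simp [siteOcc]
  have happ := productOp_apply_of_signedPerm (u := fun _ : Y => siteParity) (fun _ => fun c : Fin 4 => c) _ hF
  ext k k'
  rw [signedPerm_conj_apply _ _ happ ρ k k']
  simp only [Finset.prod_mul_distrib, Finset.prod_pow_eq_pow_sum]
  by_cases h0 : (∑ x, if (0 : Fin 2) ∈ siteOcc (k x) then 1 else 0 : ℕ) = ∑ x, if (0 : Fin 2) ∈ siteOcc (k' x) then 1 else 0
  · by_cases h1 : (∑ x, if (1 : Fin 2) ∈ siteOcc (k x) then 1 else 0 : ℕ) = ∑ x, if (1 : Fin 2) ∈ siteOcc (k' x) then 1 else 0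
    · rw [h0, h1, star_mul, star_pow, star_pow, star_neg, star_one]
      have : ∀ m m' : ℕ, ((-1 : ℂ) ^ m * (-1) ^ m') * ((-1) ^ m' * (-1) ^ m) = 1 := fun m m' => by
        rw [show ((-1 : ℂ) ^ m * (-1) ^ m') * ((-1) ^ m' * (-1) ^ m) = ((-1) ^ m * (-1) ^ m) * ((-1) ^ m' * (-1) ^ m') by ring,
          ← mul_pow, ← mul_pow, neg_one_mul, neg_neg, one_pow, one_pow, one_mul]
      rw [show ∀ a b c : ℂ, a * b * c = (a * b) * c from fun _ _ _ => rfl, this, one_mul]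
    · rw [hρ 1 k k' h1, mul_zero]
  · rw [hρ 0 k k' h0, mul_zero]

/-- `Π` commutes with every `⨂_y uPH(ε_y)` (site by site `F u = u F`). [folklore] -/
theorem parity_mul_phProd (ε : Y → ℂ) :
    productOp (fun _ : Y => siteParity) * productOp (fun y => uPH (ε y)) =
      productOp (fun y => uPH (ε y)) * productOp (fun _ : Y => siteParity) := by
  rw [productOp_mul, productOp_mul]
  congr 1
  funext y
  rw [siteParity_mul_uPH, uPH_mul_siteParity]

/-- `⨂_y uPH(−ε_y) = Π · ⨂_y uPH(ε_y)`. [folklore] -/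
theorem phProd_neg (ε : Y → ℂ) :
    productOp (fun y => uPH (-ε y)) = productOp (fun _ : Y => siteParity) * productOp (fun y => uPH (ε y)) := by
  rw [productOp_mul]
  congr 1
  funext y
  rw [siteParity_mul_uPH]

/-- The spin flip commutes with `⨂_y uPH(ε_y)` up to the sign `(−1)^{#sites}` (site by site `u_SF u = −u u_SF`). [folklore] -/
theorem spinFlip_mul_phProd (ε : Y → ℂ) :
    productOp (fun _ : Y => uSpinFlip) * productOp (fun y => uPH (ε y)) =
      ((-1 : ℂ) ^ Fintype.card Y) • (productOp (fun y => uPH (ε y)) * productOp (fun _ : Y => uSpinFlip)) := by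
  have h : ∀ y : Y, uSpinFlip * uPH (ε y) = (-1 : ℂ) • (uPH (ε y) * uSpinFlip) := fun y => by
    rw [uSpinFlip_mul_uPH, neg_one_smul]
  rw [productOp_mul, productOp_mul]
  simp_rw [h]
  rw [productOp_smul, Finset.prod_const, Finset.card_univ]

omit [DecidableEq Y] in
/-- `Πᴴ = Π`. [folklore] -/
theorem parity_conjTranspose : (productOp (fun _ : Y => siteParity))ᴴ = productOp (fun _ : Y => siteParity) := by
  rw [productOp_conjTranspose]
  congr 1
  funext y
  rw [siteParity_eq]
  ext a b; fin_cases a <;> fin_cases b <;> simp [Matrix.conjTranspose_apply]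

end Product

/-! ### §4 The window operator `phOp n` = fockspace's `particle_hole` on `{-1, …, n+1}` -/

section Window

variable (n : ℕ)

/-- **fockspace's `particle_hole`** (bipartite, `eps(p) = (−1)^p`) of the window `{-1, …, n+1}` in the occupation basis:
`⨂_x uPH (phSign x)`. [cite: EsslerEtAl2005, §2.2.4] [cite: LiebWu1968, eq. (4)] -/
def phOp (n : ℕ) : Op (PolySite (chainWindow (-1) ((n : ℤ) + 1))) 4 :=
  productOp (fun x => uPH (phSign (ofLex x.1 0)))

/-- `Uᴴ U = 1` for `U = phOp n`. [folklore] -/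
theorem phOp_conjTranspose_mul_self : (phOp n)ᴴ * phOp n = 1 :=
  phProd_conjTranspose_mul_self fun _ => phSign_cases _

/-- `U² ρ U²ᴴ = ρ`. [folklore] -/
theorem phOp_sq_conj (ρ : Op (PolySite (chainWindow (-1) ((n : ℤ) + 1))) 4) :
    (phOp n * phOp n) * ρ * (phOp n * phOp n)ᴴ = ρ :=
  phProd_sq_conj (fun _ => phSign_cases _) ρ

/-- **Sector zeros survive `phOp`.** [folklore] -/
theorem phOp_sectorRow {ρ : Op (PolySite (chainWindow (-1) ((n : ℤ) + 1))) 4}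
    (hρ : ∀ σ : Fin 2, ∀ k k',
      (∑ x, if σ ∈ siteOcc (k x) then 1 else 0 : ℕ) ≠ (∑ x, if σ ∈ siteOcc (k' x) then 1 else 0 : ℕ) → ρ k k' = 0)
    (σ : Fin 2) (k k' : TensorIndex (PolySite (chainWindow (-1) ((n : ℤ) + 1))) 4)
    (hk : (∑ x, if σ ∈ siteOcc (k x) then 1 else 0 : ℕ) ≠ (∑ x, if σ ∈ siteOcc (k' x) then 1 else 0 : ℕ)) :
    (phOp n * ρ * (phOp n)ᴴ) k k' = 0 :=
  phProd_sectorRow _ hρ σ k k' hk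

/-- **Real entries survive `phOp`.** [folklore] -/
theorem phOp_realRow {ρ : Op (PolySite (chainWindow (-1) ((n : ℤ) + 1))) 4} (hρ : ∀ k k', starRingEnd ℂ (ρ k k') = ρ k k')
    (k k' : TensorIndex (PolySite (chainWindow (-1) ((n : ℤ) + 1))) 4) :
    starRingEnd ℂ ((phOp n * ρ * (phOp n)ᴴ) k k') = (phOp n * ρ * (phOp n)ᴴ) k k' :=
  phProd_realRow (fun _ => phSign_cases _) hρ k k'

/-- The window `{-1, …, n+1}` has `n + 3` sites. [folklore] -/
theorem card_polySite_chainWindow : Fintype.card (PolySite (chainWindow (-1) ((n : ℤ) + 1))) = n + 3 := by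
  have h1 : Fintype.card (PolySite (chainWindow (-1) ((n : ℤ) + 1))) = (chainWindow (-1) ((n : ℤ) + 1)).card := by
    rw [Fintype.card_coe, lexSites, Finset.card_map]
  rw [h1, chainWindow, Finset.card_map, Int.card_Icc]
  omega

/-- **The spin flip commutes with `phOp` up to the sign `(−1)^{n+3}`.** [folklore] -/
theorem spinFlip_mul_phOp :
    productOp (fun _ => uSpinFlip) * phOp n = ((-1 : ℂ) ^ (n + 3)) • (phOp n * productOp (fun _ => uSpinFlip)) := by
  rw [phOp, spinFlip_mul_phProd, card_polySite_chainWindow]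

end Window

end Summit.Ventures.CertifiedManyBodySolver.Transport
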